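import Summits.BirchSwinnertonDyer.BirchSwinnertonDyer.Theorems.KatoDescentPotSupersingularFineSelmerLeSignedSelmer
import Summits.BirchSwinnertonDyer.BirchSwinnertonDyer.Theorems.ThetaPartnerAtTwoSignedTransportAtTwoResidualNaturality
import Summits.BirchSwinnertonDyer.BirchSwinnertonDyer.Theorems.ThetaPartnerAtTwoSignedTransportAtTwoResidualKummer
import Summits.BirchSwinnertonDyer.Rank1Residual.Additive.UnramifiedAwayBadPlaces
import Summits.BirchSwinnertonDyer.Rank1Residual.Additive.StrictSignedSelmerInftyLocal
import Literature.NumberTheory.EllipticCurves.Kobayashi2003.SignedSelmer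
import Literature.NumberTheory.EllipticCurves.Rank1Residual.Predicates
import Literature.NumberTheory.EllipticCurves.SelmerCocycleLiftUnramifiedFiniteProofs
import HarnessLib

/-!
# Lower-containment tools for the crux `SignedTransportAtTwo` (stmt-BirchSwinnertonDyer-20333, route `ThetaPartnerAtTwo`,
# line `bridge` v10, stub `stub_sel2L0`): the classical Selmer conditions over `ℚ_∞` from the residual conditions, and the
# DESCENT of a signed Kummer witness from `K_∞` to the layers `K_m`
# (lead prover bsd-wall-tp2-p1 g4; `--supports stmt-BirchSwinnertonDyer-20333`; route-independent, closes nothing)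

HONEST FRAMING. THEOREMS ONLY (no definition); nothing about any curve is asserted; BSD is not proved by any of this.
No import of any route file.

WHAT (GV Invent. Math. 142 (2000) §2 pp. 17, 28 / Kim 2009 Prop. 2.10 read at `2`; Greenberg LNM 1716 §3 Lemma 3.2; the
potss cell's tools `KatoDescentPotSupersingularFineSelmerLeSignedSelmer(Tools)` are the template):

* `§1` `infKer_le_localKerOver` — the archimedean twin of `awayKer_le_localKerOver`: vanishing on `H ⊓ D_w` gives the
  classical local condition at `w.Completion` (any number field, any curve, any `p`).
* `§2` `pushH1_mem_selmerInfty_of_residual_conditions` — over `ℚ`, `p = 2`, cyclotomic `κ`: a residual class unramified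
  outside `S₀ ∪ {2}` (Additive cell's `unramKer_le_localKerOver_of_isCyclotomic`), residually trivial at `∞` and on the
  decomposition groups above `S₀`, signed-Kummer above `2`, has Kummer image in `Sel_{2^∞}(E/ℚ_∞)`.
* `§3` `exists_forall_apply_eq_zero_of_forall_mem_localSubgroup_kerSubgroup` — a continuous function on
  `Gal(K̄_E/K_n·E)` into a discrete space vanishing on `Gal(K̄_E/K_∞·E)` vanishes on `Gal(K̄_E/K_m·E)` for large `m`
  (compactness); `exists_forall_conjH1_resOfLe_mem_localKummerOverOfEmb` — DESCENT OF THE SIGNED KUMMER WITNESS: if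
  `conj_σ (hₙ y)` satisfies the Kummer condition over `K_∞` cut out by an increasing union `⋃ₘ A_m`, then
  `conj_σ (res_{K_m/K_n} y)` satisfies the layer-`m` condition cut out by `A_m` for all large `m` (any `K`, `p`, `κ`).

References: [GreenbergVatsal2000] §2 pp. 17, 28; [BDKim2009] Prop. 2.10; [GreenbergLNM1716] §2 pp. 69–72, §3 Lemma 3.2;
[Kobayashi2003] Def. 1.1; [SerreGaloisCohomology1997] I.§2.2 Prop. 8; [Greenberg1989] §1 p. 98.
-/

set_option autoImplicit false
-- D-0017: single-problem summit, so `Summit.BirchSwinnertonDyer.BirchSwinnertonDyer.…` repeats a namespace BY DESIGN.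
set_option linter.dupNamespace false

noncomputable section

open scoped Classical AddSubgroup

open WeierstrassCurve NumberField IsDedekindDomain Field Literature Literature.NumberTheory.EllipticCurves
  Literature.NumberTheory.GaloisRepresentations Literature.NumberTheory.EllipticCurves.Kobayashi2003 ZpExtension
  Literature.NumberTheory.EllipticCurves.GreenbergVatsal2000 Literature.NumberTheory.EllipticCurves.GreenbergSelmer
  Literature.NumberTheory.EllipticCurves.Rank1Residual
  Summit.BirchSwinnertonDyer.Rank1Residual.Additive
  Summit.BirchSwinnertonDyer.Rank1Residual.X2.GreenbergVatsalUnramifiedAway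
  Summit.BirchSwinnertonDyer.BirchSwinnertonDyer.Theorems.FineSelmerLeSignedSelmer

namespace Summit.BirchSwinnertonDyer.BirchSwinnertonDyer.Theorems.SignedTransportAtTwo

universe u

/-! ## §1. The archimedean analogue of `awayKer_le_localKerOver` -/

section Archimedean

variable {K : Type u} [Field K] [NumberField K] (W : WeierstrassCurve K) (p : ℕ)
  (H : Subgroup (absoluteGaloisGroup K)) (w : InfinitePlace K)

omit [NumberField K] in
/-- **Locally trivial on the archimedean decomposition group ⇒ the classical local condition at `w`**: a class of
`H¹(H, E[p^∞])` dying on `H ⊓ D_w` (`GreenbergSelmer.infKer`) dies in `H¹(H_{K_w}, E(K̄_w))` (`localKerOver` at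
`w.Completion`) — `H_{K_w} → H` factors through `H ⊓ D_w` (`D_w` is the range of `Γ_{K_w} → Γ_K`). The twin of
`X2.GreenbergVatsalUnramifiedAway.awayKer_le_localKerOver`. [cite: Greenberg1989, §1 p. 98 (3)] -/
theorem infKer_le_localKerOver :
    GreenbergSelmer.infKer H (W.geomPrimaryTorsion p) w ≤ W.localKerOver p H w.Completion := by
  intro c hc
  obtain ⟨f, rfl⟩ := oneCocycleClass_surjective (discreteTopRep H (W.geomPrimaryTorsion p)) c
  rw [GreenbergSelmer.infKer, AddMonoidHom.mem_ker, resOfLe_oneCocycleClass_eq_zero_iff H] at hc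
  obtain ⟨a, ha⟩ := hc
  rw [Summit.BirchSwinnertonDyer.Rank1Residual.X2.GreenbergVatsalSelmerLink.oneCocycleClass_mem_localKerOver_iff]
  refine ⟨pointsMap W w.Completion (a : W.geomPoints), fun τ ↦ ?_⟩
  have hτH : resGal (K := K) w.Completion τ ∈ H := (mem_localSubgroup_iff H _ _).1 τ.2
  have hτD : resGal (K := K) w.Completion τ ∈ decompInf w := by
    rw [WeierstrassCurve.resGal_eq_absGaloisRestrict]
    exact ⟨(τ : absoluteGaloisGroup w.Completion), rfl⟩
  have hmem : resGal (K := K) w.Completion τ ∈ H ⊓ decompInf w := Subgroup.mem_inf.2 ⟨hτH, hτD⟩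
  have key := ha ⟨_, hmem⟩
  have e : subgroupInclusion (inf_le_left : H ⊓ decompInf w ≤ H) ⟨_, hmem⟩ =
      resGalSubgroup H w.Completion τ := by
    apply Subtype.ext
    rw [resGalSubgroup_apply_coe, subgroupInclusion_apply_coe]
  rw [e] at key
  rw [key, AddSubgroupClass.coe_sub, map_sub, Literature.NumberTheory.EllipticCurves.primaryComponent.coe_smul,
    pointsMap_smul W w.Completion τ (a : W.geomPoints)]

end Archimedean

/-! ## §2. The classical Selmer conditions over `ℚ_∞` from the residual conditions -/

section StepOne

variable (W : WeierstrassCurve ℚ) [W.IsElliptic] (κ : ZpExtension ℚ 2)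

/-- **The classical Selmer conditions over `ℚ_∞` from the residual conditions.** For a residual class
`c ∈ H¹(ℚ_∞, E[2^∞][2])` (cyclotomic `κ`, `S₀` a finite set of odd places): unramified outside `S₀ ∪ {2}`
(⇒ the classical condition at every good odd `v`, any reduction type in fact: Additive cell's
`unramKer_le_localKerOver_of_isCyclotomic`, GV p. 17), residually trivial on the decomposition groups above `S₀`
(⇒ `awayKer_le_localKerOver`) and at `∞` (`infKer_le_localKerOver`), and signed-Kummer at the places above `2`
(`localKummerOverOfEmb_le_localKerOverOfEmb`) — then `k(c) ∈ Sel_{2^∞}(E/ℚ_∞)`.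
[cite: GreenbergVatsal2000, §2 p. 17] [cite: GreenbergLNM1716, §2 pp. 69–72] [cite: Kobayashi2003, Def. 1.1] -/
theorem pushH1_mem_selmerInfty_of_residual_conditions (hκ : κ.IsCyclotomic)
    (S₀ : Finset (HeightOneSpectrum (𝓞 ℚ)))
    (c : subgroupH1 κ.kerSubgroup ↥((↥(W.geomPrimaryTorsion 2))[(2 : ℤ)]))
    (ha : c ∈ unramifiedOutside κ.kerSubgroup ↥((↥(W.geomPrimaryTorsion 2))[(2 : ℤ)]) 2
      (↑S₀ : Set (HeightOneSpectrum (𝓞 ℚ))))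
    (hb : ∀ (w : InfinitePlace ℚ) (σ : Field.absoluteGaloisGroup ℚ),
      Literature.NumberTheory.EllipticCurves.conjH1 κ.kerSubgroup ↥((↥(W.geomPrimaryTorsion 2))[(2 : ℤ)]) σ c ∈
        GreenbergSelmer.infKer κ.kerSubgroup ↥((↥(W.geomPrimaryTorsion 2))[(2 : ℤ)]) w)
    (hc : ∀ (v : HeightOneSpectrum (𝓞 ℚ)), ((2 : ℕ) : 𝓞 ℚ) ∈ v.asIdeal → ∀ σ : Field.absoluteGaloisGroup ℚ,
      W.conjH1 2 κ.kerSubgroup σ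
          (pushH1 κ.kerSubgroup ((↥(W.geomPrimaryTorsion 2))[(2 : ℤ)]).subtype (subtype_torsionBy_smul W 2) c) ∈
        localKummerOverOfEmb W 2 κ.kerSubgroup (closureEmb (K := ℚ) (v.adicCompletion ℚ))
          (⨆ n : ℕ, signedLocalPoints κ (v.adicCompletion ℚ) W 1 n))
    (hd : ∀ v ∈ S₀, ∀ σ : Field.absoluteGaloisGroup ℚ,
      Literature.NumberTheory.EllipticCurves.conjH1 κ.kerSubgroup ↥((↥(W.geomPrimaryTorsion 2))[(2 : ℤ)]) σ c ∈
        GreenbergSelmer.awayKer κ.kerSubgroup ↥((↥(W.geomPrimaryTorsion 2))[(2 : ℤ)]) v) :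
    pushH1 κ.kerSubgroup ((↥(W.geomPrimaryTorsion 2))[(2 : ℤ)]).subtype (subtype_torsionBy_smul W 2) c ∈
      W.selmerInfty κ := by
  set kW := pushH1 κ.kerSubgroup ((↥(W.geomPrimaryTorsion 2))[(2 : ℤ)]).subtype (subtype_torsionBy_smul W 2)
    with hkW
  have hconj : ∀ σ : Field.absoluteGaloisGroup ℚ, W.conjH1 2 κ.kerSubgroup σ (kW c) =
      kW (Literature.NumberTheory.EllipticCurves.conjH1 κ.kerSubgroup ↥((↥(W.geomPrimaryTorsion 2))[(2 : ℤ)]) σ c) :=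
    fun σ ↦ (pushH1_conjH1 κ.kerSubgroup ((↥(W.geomPrimaryTorsion 2))[(2 : ℤ)]).subtype
      (subtype_torsionBy_smul W 2) σ c).symm
  change kW c ∈ W.selmerGroupOver 2 κ.kerSubgroup
  rw [WeierstrassCurve.mem_selmerGroupOver_iff]
  refine ⟨fun v σ ↦ ?_, fun w σ ↦ ?_⟩
  · by_cases hv2 : ((2 : ℕ) : 𝓞 ℚ) ∈ v.asIdeal
    · -- above `2`: the Kummer condition refines the classical one
      rw [WeierstrassCurve.localKerOver_eq_ofEmb]
      exact localKummerOverOfEmb_le_localKerOverOfEmb _ (hc v hv2 σ)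
    · by_cases hvS : v ∈ S₀
      · -- above `S₀`: residually trivial on the decomposition group
        rw [hconj σ]
        refine awayKer_le_localKerOver (v := v) (W := W) (p := 2) κ.kerSubgroup ?_
        exact resH1Hom_id_pushH1_eq_zero κ.kerSubgroup ((↥(W.geomPrimaryTorsion 2))[(2 : ℤ)]).subtype
          (subtype_torsionBy_smul W 2) (subgroupInclusion (inf_le_left : κ.kerSubgroup ⊓ decomp v ≤ κ.kerSubgroup))
          (fun _ _ ↦ rfl) (fun _ _ ↦ rfl) _ (hd v hvS σ)
      · -- good odd place outside `S₀`: unramified ⇒ locally trivial over `ℚ_∞` (GV p. 17)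
        rw [hconj σ]
        have h1 := pushH1_mem_unramifiedKer κ.kerSubgroup ((↥(W.geomPrimaryTorsion 2))[(2 : ℤ)]).subtype
          (subtype_torsionBy_smul W 2) v ((mem_unramifiedOutside_iff _).mp ha v hvS hv2 σ)
        exact unramKer_le_localKerOver_of_isCyclotomic (κ := κ) (v := v) (W := W) (p := 2) hκ hv2 h1
  · -- archimedean place
    rw [hconj σ]
    exact infKer_le_localKerOver W 2 κ.kerSubgroup w
      (pushH1_mem_infKer κ.kerSubgroup ((↥(W.geomPrimaryTorsion 2))[(2 : ℤ)]).subtype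
        (subtype_torsionBy_smul W 2) w (hb w σ))

end StepOne

/-! ## §3. Descent of the signed Kummer witness down the tower -/

section Descent

variable {K : Type u} [Field K] (W : WeierstrassCurve K) {p : ℕ} [Fact p.Prime]
  (κ : ZpExtension K p) (E : Type u) [Field E] [Algebra K E]

/-- **Pointwise descent of vanishing down the local tower.** A continuous function on the local layer group
`Gal(K̄_E/K_n·E)` with values in a discrete space, vanishing on `Gal(K̄_E/K_∞·E) = ⋂ₘ Gal(K̄_E/K_m·E)`, vanishes on
`Gal(K̄_E/K_m·E)` for all large `m` (compactness of `Γ_E`: the closed sets `Gal(K̄_E/K_{n+j}·E) ∖ {F = 0}` decrease to `∅`).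
Serre, *Galois Cohomology*, I.§2.2 Prop. 8 (continuity of cochains down a projective limit). [cite: SerreGaloisCohomology1997, I.§2.2 Prop. 8] -/
theorem exists_forall_apply_eq_zero_of_forall_mem_localSubgroup_kerSubgroup {X : Type*} [Zero X]
    [TopologicalSpace X] [DiscreteTopology X] (n : ℕ)
    (F : localSubgroup (κ.layerSubgroup n) E → X) (hF : Continuous F)
    (hvan : ∀ τ : localSubgroup (κ.layerSubgroup n) E,
      (τ : Field.absoluteGaloisGroup E) ∈ localSubgroup κ.kerSubgroup E → F τ = 0) :
    ∃ m₀ : ℕ, ∀ m : ℕ, m₀ ≤ m → ∀ τ : localSubgroup (κ.layerSubgroup n) E,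
      (τ : Field.absoluteGaloisGroup E) ∈ localSubgroup (κ.layerSubgroup m) E → F τ = 0 := by
  haveI : CompactSpace (Field.absoluteGaloisGroup E) := absoluteGaloisGroup_compactSpace E
  -- the layer group is compact
  have hcpt : IsCompact (localSubgroup (κ.layerSubgroup n) E : Set (Field.absoluteGaloisGroup E)) :=
    (isClosed_localSubgroup_layerSubgroup κ E n).isCompact
  -- the closed sets `C j = G_{n+j} ∖ {F = 0}` (as subsets of `Γ_E`)
  set Z : Set (Field.absoluteGaloisGroup E) :=
    {g | ∃ h : g ∈ localSubgroup (κ.layerSubgroup n) E, F ⟨g, h⟩ = 0} with hZ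
  have hZopen : IsOpen ((fun τ : localSubgroup (κ.layerSubgroup n) E ↦ F τ) ⁻¹' {0}) :=
    (isOpen_discrete _).preimage hF
  obtain ⟨O, hO, hOZ⟩ := isOpen_induced_iff.mp hZopen
  have hmemO : ∀ τ : localSubgroup (κ.layerSubgroup n) E, (τ : Field.absoluteGaloisGroup E) ∈ O ↔ F τ = 0 := fun τ ↦ by
    have := congrArg (fun s : Set (localSubgroup (κ.layerSubgroup n) E) ↦ τ ∈ s) hOZ
    simpa using this
  set C : ℕ → Set (Field.absoluteGaloisGroup E) :=
    fun j ↦ ((localSubgroup (κ.layerSubgroup (n + j)) E : Set (Field.absoluteGaloisGroup E)) ∩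
      (localSubgroup (κ.layerSubgroup n) E : Set (Field.absoluteGaloisGroup E))) ∩ Oᶜ with hC
  have hCanti : ∀ j, C (j + 1) ⊆ C j := fun j ↦
    Set.inter_subset_inter_left _ (Set.inter_subset_inter_left _ (by
      exact_mod_cast Subgroup.comap_mono (κ.layerSubgroup_antitone (by omega : n + j ≤ n + (j + 1)))))
  have hCcl : ∀ j, IsClosed (C j) := fun j ↦
    ((isClosed_localSubgroup_layerSubgroup κ E (n + j)).inter (isClosed_localSubgroup_layerSubgroup κ E n)).inter
      hO.isClosed_compl
  have hC0 : IsCompact (C 0) := (hCcl 0).isCompact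
  have hempty : (⋂ j, C j) = ∅ := by
    ext g
    simp only [Set.mem_iInter, Set.mem_empty_iff_false, iff_false]
    intro hg
    have hgn : g ∈ localSubgroup (κ.layerSubgroup n) E := (hg 0).1.2
    have hgall : ∀ m, g ∈ localSubgroup (κ.layerSubgroup m) E := fun m ↦ by
      by_cases hm : n ≤ m
      · obtain ⟨j, rfl⟩ := Nat.exists_eq_add_of_le hm
        exact (hg j).1.1
      · exact Subgroup.comap_mono (κ.layerSubgroup_antitone (by omega : m ≤ n)) hgn
    have hginf : g ∈ localSubgroup κ.kerSubgroup E := mem_localSubgroup_kerSubgroup_of_forall κ E hgall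
    have hgO : g ∈ O := (hmemO ⟨g, hgn⟩).mpr (hvan ⟨g, hgn⟩ hginf)
    exact (hg 0).2 hgO
  have hex : ∃ j, C j = ∅ := by
    by_contra hne
    have hne' : ∀ j, (C j).Nonempty := fun j ↦ Set.nonempty_iff_ne_empty.mpr fun h ↦ hne ⟨j, h⟩
    obtain ⟨g, hg⟩ := IsCompact.nonempty_iInter_of_sequence_nonempty_isCompact_isClosed C hCanti hne' hC0 hCcl
    rw [hempty] at hg
    exact hg
  obtain ⟨j, hj⟩ := hex
  refine ⟨n + j, fun m hm τ hτ ↦ ?_⟩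
  by_contra hne
  have hτO : (τ : Field.absoluteGaloisGroup E) ∉ O := fun h ↦ hne ((hmemO τ).mp h)
  have hτj : (τ : Field.absoluteGaloisGroup E) ∈ localSubgroup (κ.layerSubgroup (n + j)) E :=
    Subgroup.comap_mono (κ.layerSubgroup_antitone hm) hτ
  have : (τ : Field.absoluteGaloisGroup E) ∈ C j := ⟨⟨hτj, τ.2⟩, hτO⟩
  rw [hj] at this
  exact this

/-- **Descent of the signed Kummer witness down the tower.** Let `y ∈ H¹(Gal(K̄/K_n), E[p^∞])`, `σ ∈ Γ_K`, and
`(A_m)_m` an increasing family of subgroups of `E(K̄_E)` (Kobayashi's `E^±(K_m·E)`). If the restriction of `conj_σ y` to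
`K_∞` satisfies the Kummer condition over `K_∞` cut out by `⋃ₘ A_m` — a cocycle of it is `τ ↦ τQ − Q` on
`Gal(K̄_E/K_∞·E)` with `pᵏQ ∈ ⋃ₘ A_m` — then for all large `m ≥ n` the class `conj_σ (res_{K_m/K_n} y)` satisfies the
Kummer condition at layer `m` cut out by `A_m`: the witness `pᵏQ` lies in some `A_N` (directed union), the cocycle of
`conj_σ y` may be taken to restrict to the given one (cohomologous cocycles differ by `∂t`, `t ∈ E[p^∞]`, absorbed into
`Q`), and the continuous function `τ ↦ ι ψ(res τ) − (τQ − Q)` on `Gal(K̄_E/K_n·E)`, vanishing on `Gal(K̄_E/K_∞·E)`,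
vanishes on `Gal(K̄_E/K_m·E)` for large `m` (`exists_forall_apply_eq_zero_of_forall_mem_localSubgroup_kerSubgroup`).
(The Kummer maps are compatible with the direct limit `H¹(K_{∞,w}, ·) = lim→ H¹(K_{m,w}, ·)`; Greenberg LNM 1716 §3
Lemma 3.2 / Kobayashi Def. 1.1.) [cite: GreenbergLNM1716, §3 Lemma 3.2 (p. 86)] [cite: Kobayashi2003, Def. 1.1] -/
theorem exists_forall_conjH1_resOfLe_mem_localKummerOverOfEmb (A : ℕ → AddSubgroup (localPoints W E))
    (hA : Monotone A) {n : ℕ} (y : W.subgroupH1 p (κ.layerSubgroup n)) (σ : Field.absoluteGaloisGroup K)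
    (h : W.conjH1 p κ.kerSubgroup σ (W.layerToInfty κ n y) ∈
      localKummerOverOfEmb W p κ.kerSubgroup (closureEmb (K := K) E) (⨆ m, A m)) :
    ∃ m₀ : ℕ, ∀ (m : ℕ) (hnm : n ≤ m), m₀ ≤ m →
      W.conjH1 p (κ.layerSubgroup m) σ (W.resOfLe p (κ.layerSubgroup_antitone hnm) y) ∈
        localKummerOverOfEmb W p (κ.layerSubgroup m) (closureEmb (K := K) E) (A m) := by
  set ι := closureEmb (K := K) E with hι
  rw [← W.layerToInfty_conjH1 κ σ y] at h
  set u := W.conjH1 p (κ.layerSubgroup n) σ y with hu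
  obtain ⟨ψ, hψ⟩ := oneCocycleClass_surjective (discreteTopRep (κ.layerSubgroup n) (W.geomPrimaryTorsion p)) u
  obtain ⟨φ', Q, k, hφ', hP, hτ⟩ := h
  -- `φ'` and `ψ|_{K_∞}` are cohomologous: `φ' − ψ|_{K_∞} = ∂t`
  have hres : W.layerToInfty κ n u = oneCocycleClass (discreteTopRep κ.kerSubgroup (W.geomPrimaryTorsion p))
      (contOneCocycles.pullback (subgroupInclusion (κ.kerSubgroup_le_layerSubgroup n))
        (resHomOfEquivariant (subgroupInclusion (κ.kerSubgroup_le_layerSubgroup n))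
          (AddMonoidHom.id (W.geomPrimaryTorsion p)) fun _ _ ↦ rfl) ψ) := by
    rw [← hψ]
    exact map_oneCocycleClass _ _ _ ψ
  have hdiff : oneCocycleClass _ (φ' - contOneCocycles.pullback (subgroupInclusion (κ.kerSubgroup_le_layerSubgroup n))
        (resHomOfEquivariant (subgroupInclusion (κ.kerSubgroup_le_layerSubgroup n))
          (AddMonoidHom.id (W.geomPrimaryTorsion p)) fun _ _ ↦ rfl) ψ) = 0 := by
    rw [oneCocycleClass_sub, hφ', hres, sub_self]
  obtain ⟨t, ht⟩ := (oneCocycleClass_eq_zero_iff _ _).mp hdiff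
  -- the corrected witness `Q' = Q − ι t`
  set Q' : localPoints W E := Q - pointsMapOfEmb W ι ((t : W.geomPrimaryTorsion p) : W.geomPoints) with hQ'
  have hψτ : ∀ τ : localSubgroupOfEmb κ.kerSubgroup ι,
      pointsMapOfEmb W ι ((ψ.1 ⟨resGalOfEmb ι τ, κ.kerSubgroup_le_layerSubgroup n τ.2⟩ : W.geomPrimaryTorsion p) :
        W.geomPoints) = (τ : Field.absoluteGaloisGroup E) • Q' - Q' := by
    intro τ
    have h1 := hτ τ
    have h2 := ht (resGalSubgroupOfEmb κ.kerSubgroup ι τ)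
    -- `h2 : φ'(res τ) - ψ(res τ) = res τ • t - t`
    have h3 : φ'.1 (resGalSubgroupOfEmb κ.kerSubgroup ι τ) =
        ψ.1 ⟨resGalOfEmb ι τ, κ.kerSubgroup_le_layerSubgroup n τ.2⟩ +
          ((resGalOfEmb ι (τ : Field.absoluteGaloisGroup E)) • t - t) := by
      have e : (φ' - contOneCocycles.pullback (subgroupInclusion (κ.kerSubgroup_le_layerSubgroup n))
          (resHomOfEquivariant (subgroupInclusion (κ.kerSubgroup_le_layerSubgroup n))
            (AddMonoidHom.id (W.geomPrimaryTorsion p)) fun _ _ ↦ rfl) ψ).1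
            (resGalSubgroupOfEmb κ.kerSubgroup ι τ) =
          φ'.1 (resGalSubgroupOfEmb κ.kerSubgroup ι τ) -
            ψ.1 ⟨resGalOfEmb ι τ, κ.kerSubgroup_le_layerSubgroup n τ.2⟩ := rfl
      rw [e] at h2
      have h2' : φ'.1 (resGalSubgroupOfEmb κ.kerSubgroup ι τ) -
          ψ.1 ⟨resGalOfEmb ι τ, κ.kerSubgroup_le_layerSubgroup n τ.2⟩ =
          (resGalOfEmb ι (τ : Field.absoluteGaloisGroup E)) • t - t := h2
      rw [sub_eq_iff_eq_add'] at h2'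
      rw [h2']
    have h4 := congrArg (fun x : W.geomPrimaryTorsion p ↦ pointsMapOfEmb W ι (x : W.geomPoints)) h3
    simp only [AddSubgroup.coe_add, AddSubgroup.coe_sub, map_add, map_sub,
      Literature.NumberTheory.EllipticCurves.primaryComponent.coe_smul, pointsMapOfEmb_smul] at h4
    -- `h4 : ι φ'(res τ) = ι ψ(res τ) + (τ • ι t - ι t)`; combine with `h1`
    rw [h4] at h1
    rw [hQ', smul_sub]
    have h5 := h1
    calc pointsMapOfEmb W ι ((ψ.1 ⟨resGalOfEmb ι τ, κ.kerSubgroup_le_layerSubgroup n τ.2⟩ : W.geomPrimaryTorsion p) :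
          W.geomPoints)
        = ((τ : Field.absoluteGaloisGroup E) • Q - Q) -
            ((τ : Field.absoluteGaloisGroup E) • pointsMapOfEmb W ι ((t : W.geomPrimaryTorsion p) : W.geomPoints) -
              pointsMapOfEmb W ι ((t : W.geomPrimaryTorsion p) : W.geomPoints)) := by rw [← h5]; abel
      _ = _ := by abel
  -- the corrected multiple `p^{k+k_t} Q' = p^{k_t} (p^k Q)` lies in some `A N`
  obtain ⟨kt, hkt⟩ := exists_pow_smul_geomPrimaryTorsion_eq_zero W (t : W.geomPrimaryTorsion p)
  have hP' : (p ^ (k + kt)) • Q' ∈ ⨆ m, A m := by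
    have e : (p ^ (k + kt)) • Q' = (p ^ kt) • ((p ^ k) • Q) := by
      rw [hQ', smul_sub, pow_add, mul_comm, mul_nsmul, mul_nsmul, ← map_nsmul, ← map_nsmul]
      have : p ^ kt • ((t : W.geomPrimaryTorsion p) : W.geomPoints) = 0 := by
        rw [← AddSubmonoidClass.coe_nsmul, hkt, ZeroMemClass.coe_zero]
      rw [this, smul_zero, map_zero, sub_zero, smul_comm]
    rw [e]
    exact AddSubgroup.nsmul_mem _ hP _
  obtain ⟨N, hN⟩ := (AddSubgroup.mem_iSup_of_directed hA.directed_le).mp hP'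
  -- the continuous function `F(τ) = ι ψ(res τ) − (τQ' − Q')` on `Gal(K̄_E/K_n·E)` vanishes on `Gal(K̄_E/K_∞·E)`
  set F : localSubgroup (κ.layerSubgroup n) E → localPoints W E := fun τ ↦
    pointsMapOfEmb W ι ((ψ.1 (resGalSubgroupOfEmb (κ.layerSubgroup n) ι τ) : W.geomPrimaryTorsion p) : W.geomPoints) -
      ((τ : Field.absoluteGaloisGroup E) • Q' - Q') with hFdef
  have hFcont : Continuous F := by
    have hc1 : Continuous (fun τ : localSubgroup (κ.layerSubgroup n) E ↦
        ψ.1 (resGalSubgroupOfEmb (κ.layerSubgroup n) ι τ)) :=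
      ψ.1.continuous.comp (map_continuous (resGalSubgroupOfEmb (κ.layerSubgroup n) ι))
    have hc2 : Continuous (fun τ : localSubgroup (κ.layerSubgroup n) E ↦
        pointsMapOfEmb W ι ((ψ.1 (resGalSubgroupOfEmb (κ.layerSubgroup n) ι τ) : W.geomPrimaryTorsion p) :
          W.geomPoints)) :=
      (continuous_of_discreteTopology (f := fun x : W.geomPrimaryTorsion p ↦
        pointsMapOfEmb W ι (x : W.geomPoints))).comp hc1
    exact hc2.sub (((continuous_smul_localPoints W E Q').comp continuous_subtype_val).sub continuous_const)
  have hFvan : ∀ τ : localSubgroup (κ.layerSubgroup n) E,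
      (τ : Field.absoluteGaloisGroup E) ∈ localSubgroup κ.kerSubgroup E → F τ = 0 := by
    intro τ hτinf
    have h := hψτ ⟨τ, hτinf⟩
    have e : resGalSubgroupOfEmb (κ.layerSubgroup n) ι τ =
        ⟨resGalOfEmb ι (τ : Field.absoluteGaloisGroup E), κ.kerSubgroup_le_layerSubgroup n hτinf⟩ := Subtype.ext rfl
    rw [hFdef]
    change pointsMapOfEmb W ι ((ψ.1 (resGalSubgroupOfEmb (κ.layerSubgroup n) ι τ) : W.geomPrimaryTorsion p) :
      W.geomPoints) - ((τ : Field.absoluteGaloisGroup E) • Q' - Q') = 0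
    rw [e, h, sub_self]
  obtain ⟨m₁, hm₁⟩ := exists_forall_apply_eq_zero_of_forall_mem_localSubgroup_kerSubgroup κ E n F hFcont hFvan
  refine ⟨max m₁ N, fun m hnm hm ↦ ?_⟩
  have hm₁' : m₁ ≤ m := (le_max_left _ _).trans hm
  have hN' : N ≤ m := (le_max_right _ _).trans hm
  -- `conj_σ (res y) = res (conj_σ y) = [ψ|_{K_m}]`
  rw [conjH1_resOfLe_layer W κ hnm σ y, ← hu, ← hψ]
  refine ⟨contOneCocycles.pullback (subgroupInclusion (κ.layerSubgroup_antitone hnm))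
      (resHomOfEquivariant (subgroupInclusion (κ.layerSubgroup_antitone hnm))
        (AddMonoidHom.id (W.geomPrimaryTorsion p)) fun _ _ ↦ rfl) ψ, Q', k + kt, ?_, hA hN' hN, fun τ ↦ ?_⟩
  · exact (map_oneCocycleClass _ _ _ ψ).symm
  · have hτn : (τ : Field.absoluteGaloisGroup E) ∈ localSubgroup (κ.layerSubgroup n) E :=
      Subgroup.comap_mono (κ.layerSubgroup_antitone hnm) τ.2
    have h0 := hm₁ m hm₁' ⟨τ, hτn⟩ τ.2
    rw [hFdef, sub_eq_zero] at h0
    rw [contOneCocycles.pullback_apply]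
    have e : subgroupInclusion (κ.layerSubgroup_antitone hnm) (resGalSubgroupOfEmb (κ.layerSubgroup m) ι τ) =
        resGalSubgroupOfEmb (κ.layerSubgroup n) ι ⟨τ, hτn⟩ := Subtype.ext rfl
    rw [e]
    exact h0

end Descent



end Summit.BirchSwinnertonDyer.BirchSwinnertonDyer.Theorems.SignedTransportAtTwo

end
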